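import Mathlib
import Summits.ResolutionOfSingularities.ResolutionOfSingularities.Theorems.WeightedInvariantLocalWeightedDropNCResSettingHeadDropMaxCentre

/-!
# `WeightedInvariant.LocalWeightedDrop`: NC-resolution settings for the TOT₂ line — THE SURFACE MOVE AT APEX DIMENSION `e ≤ 2`:
# reading «directrix ⊆ tangent space of the centre» from the engine's dependence binders, and the one-move exit from a permissible
# coordinate plane of letter-preserving coordinates (every dimension, every field)

Crux item stmt-ResolutionOfSingularities-8899 `LocalWeightedDrop` (route `ResolutionOfSingularities/WeightedInvariant`), ENGINE skeleton v32,
residuals `stub_spaceNCRankDrop` (m = 2) and `stub_wildWideApexFourStartsWon` (W4|₄, m = 3; res-L1-w43-strat-1's line `directrix-cut` v3, regime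
`apexPlane₃` = apex dimension `e = 2` in four letters, sub-case «the `c`-fold locus of `g` is a smooth SURFACE germ tangent to the directrix plane»).
[OURS · L1 W4.3 · chain w43 · seat res-L1-w43-stub-4 gen 5; def-free; sequel of `…NCResSettingHeadDropMaxCentre` (p541088); on res-L1-w43-stub-1's
S-SET and res-L1-w43-stub-3's (N3); the count game is the programme's own; nothing here is a statement of any manuscript; AI-produced, gate-checked,
weaker than expert review.]

`…HeadDropMaxCentre` proved: a B-permissible move whose centre's tangent space CONTAINS the directrix of `in_c(Φ^* g)` (hypothesis `hdir`: every
invariance vector vanishes on the weight-`1` slots) drops the head at every answer.  The engine and the line state apex dimensions through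
DEPENDENCE BINDERS (`hone`: every two invariance vectors dependent, `e ≤ 1`; `htwo`: every three dependent, `e ≤ 2`).  This file converts:
* `TOT2Near.dir_le_centre_of_apexLine` — `e ≤ 1` and exactly ONE weight-`0` slot ⇒ `hdir` (the tangent letter is an invariance vector by
  permissibility, `initEval_add_eq_of_perm`; a second independent one is excluded);
* `TOT2Near.dir_le_centre_of_apexPlane` — `e ≤ 2` and exactly TWO weight-`0` slots `a ≠ b` ⇒ `hdir`;
* `TameFourTupleDrop.apexPlane_subst_legal` — `e ≤ 2` passes to the move's coordinates (triples version of res-L1-w43-stub-1's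
  `apexLine_subst_legal`, via `inv_subst_legal`);
* **`TameFourTupleDrop.dWinsTo_headDrop_of_surfaceCentre`** — THE SURFACE MOVE: from an admissibly decorated position with `e(g) ≤ 2` (in its own
  coordinates), a letter-preserving legal `Φ` and two slots `a ≠ b` such that the coordinate subspace `V(x_j : j ∉ {a, b})` of the `Φ`-coordinates is
  permissible for `g = f · ∏_O x_l` (`c ≤ weightedOrder_{𝟙_{∉{a,b}}} (Φ^* g)`: the image surface is `c`-fold for `g`) force «admissibly decorated of
  smaller head» in ONE move (`m ≥ 2`, so that the centre is not the whole space).  With `…HeadDropCurve`'s `dWinsTo_headDrop_of_inAxisIdeal` (`e ≤ 1`,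
  curve) and `dWinsTo_headDrop_of_apexTrivial` (`e = 0`, point) this completes the one-move exits «maximal contact centre normal crossing with the
  boundary» for `e ≤ 2`; what remains at `e = 2` in four letters is (i) making such a surface normal crossing with the boundary by smaller centres
  at constant head, (ii) the states whose `c`-fold locus has dimension `≤ 1` (Cossart–Jannsen–Saito Thms 5.35/5.40 one dimension up).
-/

set_option linter.dupNamespace false -- mandated namespace of this single-conjunct summit

noncomputable section

namespace Summit.ResolutionOfSingularities.ResolutionOfSingularities.Theorems

open Literature.AlgebraicGeometry.Resolution

namespace TOT2Near

open MvPowerSeries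

variable {k : Type} [Field k] {n : ℕ}

/-- For weights `w ∈ {0,1}` and a permissible `f`, the unit vector of a weight-`0` slot is an invariance vector of the degree-`o` form
(`initEval_add_eq_of_perm` at `Pi.single l 1`). [OURS · L1 W4.3] -/
theorem inv_single_of_weight_zero {w : Fin (n + 1) → ℕ} (hw : ∀ l, w l ≤ 1) {f : MvPowerSeries (Fin (n + 1)) k} {o : ℕ}
    (hperm : (o : ℕ∞) ≤ f.weightedOrder w) {l : Fin (n + 1)} (hl : w l = 0) (v : Fin (n + 1) → k) :
    CobordantChart.initEval (fun _ : Fin (n + 1) => 1) (v + Pi.single l 1) o f = CobordantChart.initEval (fun _ : Fin (n + 1) => 1) v o f :=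
  initEval_add_eq_of_perm hw hperm (fun l' hl' => by
    rw [Pi.single_apply, if_neg]
    rintro rfl
    exact hl' hl) v

/-- **`e ≤ 1` AND A ONE-LETTER TANGENT SPACE ⇒ `Dir ⊆ T_x C`.**  If every two invariance vectors of the degree-`o` form of a permissible `f` are
dependent and `l₀` is the ONLY weight-`0` slot, every invariance vector is supported on `l₀` (the hypothesis `hdir` of
`order_slice_lt_of_dir_le_centre` / `dWinsTo_headDrop_of_dirInCentre`). [OURS · L1 W4.3] -/
theorem dir_le_centre_of_apexLine {w : Fin (n + 1) → ℕ} (hw : ∀ l, w l ≤ 1) {f : MvPowerSeries (Fin (n + 1)) k} {o : ℕ}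
    (hperm : (o : ℕ∞) ≤ f.weightedOrder w) {l₀ : Fin (n + 1)} (hl₀ : w l₀ = 0) (honly : ∀ l, l ≠ l₀ → w l ≠ 0)
    (hone : ∀ u₁ u₂ : Fin (n + 1) → k,
      (∀ v, CobordantChart.initEval (fun _ : Fin (n + 1) => 1) (v + u₁) o f = CobordantChart.initEval (fun _ : Fin (n + 1) => 1) v o f) →
      (∀ v, CobordantChart.initEval (fun _ : Fin (n + 1) => 1) (v + u₂) o f = CobordantChart.initEval (fun _ : Fin (n + 1) => 1) v o f) →
      ∃ α β : k, (α ≠ 0 ∨ β ≠ 0) ∧ α • u₁ + β • u₂ = 0)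
    (u : Fin (n + 1) → k)
    (hu : ∀ v, CobordantChart.initEval (fun _ : Fin (n + 1) => 1) (v + u) o f = CobordantChart.initEval (fun _ : Fin (n + 1) => 1) v o f) :
    ∀ l, w l ≠ 0 → u l = 0 := by
  intro l hl
  have hll₀ : l ≠ l₀ := by
    rintro rfl
    exact hl hl₀
  obtain ⟨α, β, hαβ, hrel⟩ := hone (Pi.single l₀ 1) u (inv_single_of_weight_zero hw hperm hl₀) hu
  have h0 := congr_fun hrel l₀
  have h1 := congr_fun hrel l
  simp only [Pi.add_apply, Pi.smul_apply, smul_eq_mul, Pi.single_eq_same, mul_one, Pi.zero_apply] at h0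
  simp only [Pi.add_apply, Pi.smul_apply, smul_eq_mul, Pi.single_eq_of_ne hll₀, mul_zero, zero_add, Pi.zero_apply,
    mul_eq_zero] at h1
  rcases h1 with hβ | hul
  · -- `β = 0` forces `α = 0`: contradiction
    rw [hβ, zero_mul, add_zero] at h0
    exact absurd h0 (hαβ.resolve_right (not_not.mpr hβ))
  · exact hul

/-- **`e ≤ 2` AND A TWO-LETTER TANGENT SPACE ⇒ `Dir ⊆ T_x C`.**  If every three invariance vectors of the degree-`o` form of a permissible `f`
are dependent and `a ≠ b` are the ONLY weight-`0` slots, every invariance vector is supported on `{a, b}`. [OURS · L1 W4.3] -/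
theorem dir_le_centre_of_apexPlane {w : Fin (n + 1) → ℕ} (hw : ∀ l, w l ≤ 1) {f : MvPowerSeries (Fin (n + 1)) k} {o : ℕ}
    (hperm : (o : ℕ∞) ≤ f.weightedOrder w) {a b : Fin (n + 1)} (hab : a ≠ b) (ha : w a = 0) (hb : w b = 0)
    (honly : ∀ l, l ≠ a → l ≠ b → w l ≠ 0)
    (htwo : ∀ u₁ u₂ u₃ : Fin (n + 1) → k,
      (∀ v, CobordantChart.initEval (fun _ : Fin (n + 1) => 1) (v + u₁) o f = CobordantChart.initEval (fun _ : Fin (n + 1) => 1) v o f) →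
      (∀ v, CobordantChart.initEval (fun _ : Fin (n + 1) => 1) (v + u₂) o f = CobordantChart.initEval (fun _ : Fin (n + 1) => 1) v o f) →
      (∀ v, CobordantChart.initEval (fun _ : Fin (n + 1) => 1) (v + u₃) o f = CobordantChart.initEval (fun _ : Fin (n + 1) => 1) v o f) →
      ∃ α β γ : k, (α ≠ 0 ∨ β ≠ 0 ∨ γ ≠ 0) ∧ α • u₁ + β • u₂ + γ • u₃ = 0)
    (u : Fin (n + 1) → k)
    (hu : ∀ v, CobordantChart.initEval (fun _ : Fin (n + 1) => 1) (v + u) o f = CobordantChart.initEval (fun _ : Fin (n + 1) => 1) v o f) :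
    ∀ l, w l ≠ 0 → u l = 0 := by
  intro l hl
  have hla : l ≠ a := by
    rintro rfl
    exact hl ha
  have hlb : l ≠ b := by
    rintro rfl
    exact hl hb
  obtain ⟨α, β, γ, hne, hrel⟩ := htwo (Pi.single a 1) (Pi.single b 1) u (inv_single_of_weight_zero hw hperm ha)
    (inv_single_of_weight_zero hw hperm hb) hu
  have hA := congr_fun hrel a
  have hB := congr_fun hrel b
  have hL := congr_fun hrel l
  simp only [Pi.add_apply, Pi.smul_apply, smul_eq_mul, Pi.single_eq_same, Pi.single_eq_of_ne hab, mul_one, mul_zero, add_zero,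
    Pi.zero_apply] at hA
  simp only [Pi.add_apply, Pi.smul_apply, smul_eq_mul, Pi.single_eq_same, Pi.single_eq_of_ne hab.symm, mul_one, mul_zero, zero_add,
    Pi.zero_apply] at hB
  simp only [Pi.add_apply, Pi.smul_apply, smul_eq_mul, Pi.single_eq_of_ne hla, Pi.single_eq_of_ne hlb, mul_zero, zero_add, Pi.zero_apply,
    mul_eq_zero] at hL
  rcases hL with hγ | hul
  · -- `γ = 0` forces `α = β = 0`: contradiction
    rw [hγ, zero_mul, add_zero] at hA hB
    exact absurd hγ (hne.resolve_left (not_not.mpr hA) |>.resolve_left (not_not.mpr hB))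
  · exact hul

end TOT2Near

namespace TameFourTupleDrop

open MvPowerSeries AxisPolyhedron

variable {k : Type} [Field k] {m : ℕ}

/-- **APEX DIMENSION ≤ 2 PASSES TO THE MOVE'S COORDINATES**: if every three invariance vectors of `in_d g` are dependent, so are every three
invariance vectors of `in_d (Φ^* g)` for a legal `Φ` (the linear part `M` of `Φ` maps invariance vectors of `Φ^* g` injectively to invariance
vectors of `g`, `inv_subst_legal`). [OURS · L1 W4.3] -/
theorem apexPlane_subst_legal {n : ℕ} (Φ : Fin (n + 1) → MvPowerSeries (Fin (n + 1)) k) (hΦ0 : ∀ i, constantCoeff (Φ i) = 0)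
    (hΦdet : IsUnit (Matrix.det (Matrix.of fun i j : Fin (n + 1) => coeff (Finsupp.single j 1) (Φ i))))
    (g : MvPowerSeries (Fin (n + 1)) k) {d : ℕ} (hgd : g.order = d)
    (htwo : ∀ u₁ u₂ u₃ : Fin (n + 1) → k,
      (∀ v, CobordantChart.initEval (fun _ : Fin (n + 1) => 1) (v + u₁) d g = CobordantChart.initEval (fun _ : Fin (n + 1) => 1) v d g) →
      (∀ v, CobordantChart.initEval (fun _ : Fin (n + 1) => 1) (v + u₂) d g = CobordantChart.initEval (fun _ : Fin (n + 1) => 1) v d g) →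
      (∀ v, CobordantChart.initEval (fun _ : Fin (n + 1) => 1) (v + u₃) d g = CobordantChart.initEval (fun _ : Fin (n + 1) => 1) v d g) →
      ∃ α β γ : k, (α ≠ 0 ∨ β ≠ 0 ∨ γ ≠ 0) ∧ α • u₁ + β • u₂ + γ • u₃ = 0)
    (u₁ u₂ u₃ : Fin (n + 1) → k)
    (hu₁ : ∀ v, CobordantChart.initEval (fun _ : Fin (n + 1) => 1) (v + u₁) d (subst Φ g) =
      CobordantChart.initEval (fun _ : Fin (n + 1) => 1) v d (subst Φ g))
    (hu₂ : ∀ v, CobordantChart.initEval (fun _ : Fin (n + 1) => 1) (v + u₂) d (subst Φ g) =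
      CobordantChart.initEval (fun _ : Fin (n + 1) => 1) v d (subst Φ g))
    (hu₃ : ∀ v, CobordantChart.initEval (fun _ : Fin (n + 1) => 1) (v + u₃) d (subst Φ g) =
      CobordantChart.initEval (fun _ : Fin (n + 1) => 1) v d (subst Φ g)) :
    ∃ α β γ : k, (α ≠ 0 ∨ β ≠ 0 ∨ γ ≠ 0) ∧ α • u₁ + β • u₂ + γ • u₃ = 0 := by
  set M : Matrix (Fin (n + 1)) (Fin (n + 1)) k := Matrix.of fun i j : Fin (n + 1) => coeff (Finsupp.single j 1) (Φ i) with hM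
  have hinj : Function.Injective M.mulVec :=
    Matrix.mulVec_injective_iff_isUnit.mpr ((Matrix.isUnit_iff_isUnit_det M).mpr hΦdet)
  obtain ⟨α, β, γ, hne, hlin⟩ := htwo (M.mulVec u₁) (M.mulVec u₂) (M.mulVec u₃) (inv_subst_legal Φ hΦ0 hΦdet g hgd hu₁)
    (inv_subst_legal Φ hΦ0 hΦdet g hgd hu₂) (inv_subst_legal Φ hΦ0 hΦdet g hgd hu₃)
  refine ⟨α, β, γ, hne, hinj ?_⟩
  rw [Matrix.mulVec_add, Matrix.mulVec_add, Matrix.mulVec_smul, Matrix.mulVec_smul, Matrix.mulVec_smul, hlin, Matrix.mulVec_zero]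

/-- **THE SURFACE MOVE AT APEX DIMENSION ≤ 2 WINS THE HEAD PHASE IN ONE MOVE** (OURS · L1 W4.3; every `m ≥ 2`, every field).  From an admissibly
decorated position `(b, δ)` with `e(g) ≤ 2` (every three invariance vectors of `in_c g` dependent, `g = f · ∏_O x_l`, in the position's own
coordinates), a letter-preserving legal `Φ` and two slots `a ≠ b` such that the codimension-two coordinate subspace `V(x_j : j ∉ {a, b})` of the
`Φ`-coordinates is permissible for `g` (`c ≤ weightedOrder_{𝟙_{j ∉ {a,b}}} (Φ^* g)`: its image is a `c`-fold smooth surface germ of `g`, necessarily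
tangent to the directrix plane) force «admissibly decorated of strictly smaller head» in one move: the move `(Φ, 𝟙_{j ∉ {a,b}})` is B-permissible
(`dWinsTo_headDrop_of_inCentreIdeal`) and has no near point (`dir_le_centre_of_apexPlane` after `apexPlane_subst_legal`). -/
theorem dWinsTo_headDrop_of_surfaceCentre {b : MvPowerSeries (Fin (m + 1)) k} {δ : Decoration k m} (hadm : Admissible b δ) (hm : 2 ≤ m)
    {Φ : Fin (m + 1) → MvPowerSeries (Fin (m + 1)) k} (hΦ0 : ∀ i, constantCoeff (Φ i) = 0)
    (hΦdet : IsUnit (Matrix.det (Matrix.of fun i j : Fin (m + 1) => coeff (Finsupp.single j 1) (Φ i))))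
    (hP3 : ∀ l ∈ δ.E, ∃ (l' : Fin (m + 1)) (u : MvPowerSeries (Fin (m + 1)) k), constantCoeff u ≠ 0 ∧ Φ l = u * X l')
    {a b' : Fin (m + 1)} (hab : a ≠ b')
    (hin : (δ.c : ℕ∞) ≤ (subst Φ (δ.f * ∏ l ∈ δ.O, X l)).weightedOrder (fun j => if j = a ∨ j = b' then 0 else 1))
    (htwo : ∀ u₁ u₂ u₃ : Fin (m + 1) → k,
      (∀ v, CobordantChart.initEval (fun _ : Fin (m + 1) => 1) (v + u₁) δ.c (δ.f * ∏ l ∈ δ.O, X l) =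
        CobordantChart.initEval (fun _ : Fin (m + 1) => 1) v δ.c (δ.f * ∏ l ∈ δ.O, X l)) →
      (∀ v, CobordantChart.initEval (fun _ : Fin (m + 1) => 1) (v + u₂) δ.c (δ.f * ∏ l ∈ δ.O, X l) =
        CobordantChart.initEval (fun _ : Fin (m + 1) => 1) v δ.c (δ.f * ∏ l ∈ δ.O, X l)) →
      (∀ v, CobordantChart.initEval (fun _ : Fin (m + 1) => 1) (v + u₃) δ.c (δ.f * ∏ l ∈ δ.O, X l) =
        CobordantChart.initEval (fun _ : Fin (m + 1) => 1) v δ.c (δ.f * ∏ l ∈ δ.O, X l)) →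
      ∃ α β γ : k, (α ≠ 0 ∨ β ≠ 0 ∨ γ ≠ 0) ∧ α • u₁ + β • u₂ + γ • u₃ = 0) :
    DWinsTo (St := MvPowerSeries (Fin (m + 1)) k × Decoration k m) Prod.fst
      (fun τ => Admissible τ.1 τ.2 ∧ τ.2.head < δ.head) (b, δ) := by
  classical
  set w : Fin (m + 1) → ℕ := fun j => if j = a ∨ j = b' then 0 else 1 with hw
  have hw1 : ∀ l, w l ≤ 1 := fun l => by
    simp only [hw]
    split_ifs <;> omega
  -- a third slot carries weight `1` (`m ≥ 2`)
  have hwpos : ∃ l, 0 < w l := by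
    have hcard : 2 < (Finset.univ : Finset (Fin (m + 1))).card := by
      rw [Finset.card_univ, Fintype.card_fin]
      omega
    obtain ⟨l, -, hl⟩ := Finset.exists_mem_notMem_of_card_lt_card (s := {a, b'}) (t := (Finset.univ : Finset (Fin (m + 1))))
      (lt_of_le_of_lt (Finset.card_le_two) hcard)
    refine ⟨l, ?_⟩
    have hla : l ≠ a := fun h => hl (by rw [h]; exact Finset.mem_insert_self _ _)
    have hlb : l ≠ b' := fun h => hl (by rw [h]; exact Finset.mem_insert_of_mem (Finset.mem_singleton_self _))
    simp only [hw, if_neg (not_or.mpr ⟨hla, hlb⟩)]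
    exact Nat.one_pos
  have ha : w a = 0 := by simp only [hw, if_pos (Or.inl rfl)]
  have hb : w b' = 0 := by simp only [hw, if_pos (Or.inr rfl)]
  have honly : ∀ l, l ≠ a → l ≠ b' → w l ≠ 0 := fun l hla hlb => by
    simp only [hw, if_neg (not_or.mpr ⟨hla, hlb⟩)]
    exact one_ne_zero
  have hmv : IsCountMove Φ w := ⟨hΦ0, hΦdet, hw1, hwpos⟩
  have hgd : (subst Φ (δ.f * ∏ l ∈ δ.O, X l)).order = (δ.c : ℕ∞) := Decoration.order_subst_totalO hadm hmv
  refine dWinsTo_headDrop_of_inCentreIdeal hadm hΦ0 hΦdet hP3 hw1 hwpos hin ?_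
  exact TOT2Near.dir_le_centre_of_apexPlane hw1 hin hab ha hb honly
    (apexPlane_subst_legal Φ hΦ0 hΦdet _ (Decoration.order_totalO hadm) htwo)

end TameFourTupleDrop

end Summit.ResolutionOfSingularities.ResolutionOfSingularities.Theorems

end
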